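import Summits.QuantumFields.BalabanUV.Beta.D1BFx.MomentTransferPeriodicMaster

/-!
# `BalabanUV.Beta.D1BFx.MomentTransferPeriodicSum` — road «BF-x» for binder row D1, leaf K-R5 (part 2):
# the block-periodic moment transfer OVER `ℝ` WITH EVERY SUMMABILITY DISCHARGED — majorant engine, the coarse-point /
# coarse-lattice forms of the dressed sum `K(y) = Σ'_{(u,x)} w u · P (y + u) x · w' x`, and the base-point-averaged
# first moment of a SYMMETRIC block-periodic kernel vanishing identically

HONEST FRAMING (cell contract, verbatim): «discharging `BetaPertH` makes Bałaban's UV stability UNCONDITIONAL — a real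
constructive-QFT result; it is NOT the continuum limit and NOT the Clay problem.»  [folklore] bookkeeping of absolutely
convergent lattice sums, composed BY NAME from `MomentTransferPeriodic(Master)` (this leaf, parts 1) and the engine of
`DecimatedMomentSummable` §5–§6 / `DecimatedMomentLimit.hasSum_decimate_iff`; nothing of the manuscripts under audit is
asserted or cited; no `Prop` fact minted; nothing of D1 / BetaPertH discharged.  Value = kernel bookkeeping leaf of road
BF-x (skeleton `HOME/beta/skeletons/D1-b2b-balaban-beta-d1-p2.md` v1.4 node R5; `TYPER-SPEC-D1BFx.md` §2 K-R5), NOT summit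
progress; NOT continuum, NOT Clay.  HONEST DEPENDENCY (verbatim): continuum YM on T⁴ ⇐ BetaPertH ∧ nine spine estimates
(0/9 proved); BetaPertH ⇐ (D1) ∧ (D4) ∧ CAP+tail; G-an2-4 gates asym, D1 and NE2/3/4.

CONTENT (all [folklore], over `ℝ`, `d`, `N` general):
* §1 MAJORANT ENGINE: `summable_termP_of_bound` (three absolutely summable second moments, the kernel's replaced by a
  base-point-uniform majorant `F`, `|P (b+t) b| ≤ F t`), `monoSummableP_of_majorant`, `absMoment₂_baseKer_of_majorant`,
  `summable_row_of_majorant`; for a block-periodic kernel the majorant `periodicMajorant N P t = Σ_{classes b} |P (b+t) b|`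
  from per-base-point absolute second moments (`absMoment₂_periodicMajorant`, `abs_baseKer_le_periodicMajorant`).
* §2 THE DRESSED SUM `dressedSumP w P w' y = Σ'_{(u,x)} w u · P (y+u) x · w' x` (= `DecimatedMomentSummable.dressedSum` for
  `P s s' = T (s − s')`), fibrewise summability, REGROUPING by the coarse point (`hasSum_coarseP`) and DECIMATION to the
  coarse lattice `y = N • z` (`hasSum_latticeP_iff`).
* §3 (T1-avg) FOR FREE: for a SYMMETRIC block-periodic kernel the base-point-summed first moments vanish,
  `Σ_{classes b} Σ'_t t_μ · P (b+t) b = 0` (`sum_firstMoment_baseKer_eq_zero_of_symm`; shifted residue systems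
  `sum_resSite_sub_eq`).
* §4 THE FINALS: `decimatedSumP_second_moment` (fine-point ∧ coarse-point form) and `decimatedSumP_second_moment_lattice`
  — patterns with `AbsMoment₂` reproducing constants AND affine functions through `N•ℤ^d` on both sides, `P` block
  periodic with absolutely summable base-point kernels whose columns and rows sum to zero and whose base-point-summed
  first moments vanish: the decimated second moment of the sandwich is `σ · σ' · Σ_{classes b} Σ'_t t_κ t_λ P (b+t) b`;
  `…_of_symm`: the same for a SYMMETRIC kernel killing constants (rows ⇒ columns, (T1-avg) automatic).
-/

namespace Summit.QuantumFields.BalabanUV.Beta.D1BFx.MomentTransferPeriodicSum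

open Finset Filter Topology
open Literature.MathematicalPhysics.QuantumFieldTheory.Balaban1983to89
open Literature.MathematicalPhysics.QuantumFieldTheory.Balaban1983to89.Beta
open B12Sec2to5 (l1 l1_nonneg abs_coord_le_l1)
open DecimatedMoment (cosetInd)
open DecimatedMomentLimit (hasSum_decimate_iff weight_zsmul abs_cosetInd_le_one)
open DecimatedMomentSummable (mono IsMoment₂ ConstReproSum LinReproSum AbsMoment₂ abs_le_of_isMoment₂ summable_of_absMoment₂
  summable_smul_of_absMoment₂ dressedSum coarseEquiv)
open DressedMomentNormalisation (resSite resOf dvd_resSite_sub_iff)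
open MomentTransferPeriodic MomentTransferPeriodicMaster

variable {d N : ℕ}

/-! ## §1 The majorant engine: every summability from absolutely summable second moments -/

/-- The positive weight family of an absolutely summable second moment is non-negative. [folklore] -/
theorem weightAbs_nonneg (f : (Fin d → ℤ) → ℝ) : 0 ≤ fun y => (1 + l1 y ^ 2) * |f y| :=
  fun y => mul_nonneg (by positivity) (abs_nonneg _)

/-- **ENGINE.**  Weight of at most quadratic growth in each variable separately, patterns `w, w'` with absolutely
summable second moments, and a base-point-UNIFORM majorant `F` of the kernel (`|P (b+t) b| ≤ F t`) with absolutely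
summable second moment: the triple family `termP` is summable on `ℤ^d × ℤ^d × ℤ^d` (the proof of
`DecimatedMomentSummable.summable_term_of_bound` with `|T t|` replaced by `F t`). [folklore] -/
theorem summable_termP_of_bound {w w' F : (Fin d → ℤ) → ℝ} {P : Ker₂ d} (hw : AbsMoment₂ w) (hF : AbsMoment₂ F)
    (hw' : AbsMoment₂ w') (hPF : ∀ b t, |P (b + t) b| ≤ F t)
    {g : (Fin d → ℤ) → (Fin d → ℤ) → (Fin d → ℤ) → ℤ} {B : ℝ}
    (hg : ∀ u t x, |(g u t x : ℝ)| ≤ B * ((1 + l1 u ^ 2) * ((1 + l1 t ^ 2) * (1 + l1 x ^ 2)))) :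
    Summable (termP N w P w' g) := by
  have hM : Summable (fun q : (Fin d → ℤ) × (Fin d → ℤ) × (Fin d → ℤ) =>
      B * (((1 + l1 q.1 ^ 2) * |w q.1|) * (((1 + l1 q.2.1 ^ 2) * |F q.2.1|) * ((1 + l1 q.2.2 ^ 2) * |w' q.2.2|)))) :=
    (hw.mul_of_nonneg (hF.mul_of_nonneg hw' (weightAbs_nonneg F) (weightAbs_nonneg w')) (weightAbs_nonneg w)
      (fun _ => mul_nonneg (weightAbs_nonneg F _) (weightAbs_nonneg w' _))).mul_left B
  refine Summable.of_norm_bounded hM (fun q => ?_)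
  obtain ⟨u, t, x⟩ := q
  rw [Real.norm_eq_abs, termP_apply, zsmul_eq_mul, Int.cast_mul, abs_mul, abs_mul, abs_mul, abs_mul]
  have h1 : |(cosetInd N (t + x - u) : ℝ)| * |(g u t x : ℝ)|
      ≤ 1 * (B * ((1 + l1 u ^ 2) * ((1 + l1 t ^ 2) * (1 + l1 x ^ 2)))) :=
    mul_le_mul (abs_cosetInd_le_one N _) (hg u t x) (abs_nonneg _) zero_le_one
  have h2 : |P (x + t) x| ≤ |F t| := (hPF x t).trans (le_abs_self _)
  have h3 : |w u| * |P (x + t) x| * |w' x| ≤ |w u| * |F t| * |w' x| :=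
    mul_le_mul_of_nonneg_right (mul_le_mul_of_nonneg_left h2 (abs_nonneg _)) (abs_nonneg _)
  calc |(cosetInd N (t + x - u) : ℝ)| * |(g u t x : ℝ)| * (|w u| * |P (x + t) x| * |w' x|)
      ≤ |(cosetInd N (t + x - u) : ℝ)| * |(g u t x : ℝ)| * (|w u| * |F t| * |w' x|) :=
        mul_le_mul_of_nonneg_left h3 (by positivity)
    _ ≤ 1 * (B * ((1 + l1 u ^ 2) * ((1 + l1 t ^ 2) * (1 + l1 x ^ 2)))) * (|w u| * |F t| * |w' x|) :=
        mul_le_mul_of_nonneg_right h1 (by positivity)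
    _ = B * (((1 + l1 u ^ 2) * |w u|) * (((1 + l1 t ^ 2) * |F t|) * ((1 + l1 x ^ 2) * |w' x|))) := by ring

/-- Majorant ⟹ `MonoSummableP` (window bounded by `1`, letters of degree `≤ 2`). [folklore] -/
theorem monoSummableP_of_majorant {w w' F : (Fin d → ℤ) → ℝ} {P : Ker₂ d} (hw : AbsMoment₂ w) (hF : AbsMoment₂ F)
    (hw' : AbsMoment₂ w') (hPF : ∀ b t, |P (b + t) b| ≤ F t) : MonoSummableP N w P w' := by
  intro p q r hp hq hr
  refine summable_termP_of_bound hw hF hw' hPF (B := 1) (fun u t x => ?_)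
  rw [one_mul]
  simp only [mono, Int.cast_mul, abs_mul]
  exact mul_le_mul (abs_le_of_isMoment₂ hp u) (mul_le_mul (abs_le_of_isMoment₂ hq t)
    (abs_le_of_isMoment₂ hr x) (abs_nonneg _) (by positivity)) (by positivity) (by positivity)

/-- Majorant ⟹ every base-point kernel has an absolutely summable second moment. [folklore] -/
theorem absMoment₂_baseKer_of_majorant {F : (Fin d → ℤ) → ℝ} {P : Ker₂ d} (hF : AbsMoment₂ F)
    (hPF : ∀ b t, |P (b + t) b| ≤ F t) (b : Fin d → ℤ) : AbsMoment₂ (baseKer P b) := by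
  refine Summable.of_nonneg_of_le (fun t => mul_nonneg (by positivity) (abs_nonneg _)) (fun t => ?_) hF
  exact mul_le_mul_of_nonneg_left (((hPF b t).trans (le_abs_self _))) (by positivity)

/-- Majorant ⟹ a uniform bound of the kernel: `|P s s'| ≤ Σ'_t (1 + |t|₁²)|F t|`. [folklore] -/
theorem abs_le_tsum_of_majorant {F : (Fin d → ℤ) → ℝ} {P : Ker₂ d} (hF : AbsMoment₂ F)
    (hPF : ∀ b t, |P (b + t) b| ≤ F t) (s s' : Fin d → ℤ) : |P s s'| ≤ ∑' t, (1 + l1 t ^ 2) * |F t| := by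
  have h1 : |P s s'| ≤ |F (s - s')| := by
    have := hPF s' (s - s')
    rw [add_sub_cancel] at this
    exact this.trans (le_abs_self _)
  have h2 : |F (s - s')| ≤ (1 + l1 (s - s') ^ 2) * |F (s - s')| := by
    have := abs_nonneg (F (s - s'))
    nlinarith [sq_nonneg (l1 (s - s'))]
  exact h1.trans (h2.trans (hF.le_tsum (s - s') (fun t _ => weightAbs_nonneg F t)))

/-- Majorant ⟹ every ROW `s' ↦ P b s'` is summable (`|P b s'| ≤ |F (b − s')|`). [folklore] -/
theorem summable_row_of_majorant {F : (Fin d → ℤ) → ℝ} {P : Ker₂ d} (hF : AbsMoment₂ F)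
    (hPF : ∀ b t, |P (b + t) b| ≤ F t) (b : Fin d → ℤ) : Summable (P b) := by
  have hs : Summable (fun s' => |F (b - s')|) :=
    ((Equiv.summable_iff (Equiv.subLeft b)).mpr (summable_of_absMoment₂ hF).abs)
  refine Summable.of_norm_bounded hs (fun s' => ?_)
  rw [Real.norm_eq_abs]
  have := hPF s' (b - s')
  rw [add_sub_cancel] at this
  exact this.trans (le_abs_self _)

/-- The PERIODIC MAJORANT of a block-periodic kernel: `Σ_{classes b} |P (b+t) b|`. [folklore] -/
noncomputable def periodicMajorant (N : ℕ) (P : Ker₂ d) (t : Fin d → ℤ) : ℝ :=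
  ∑ r : Fin d → Fin N, |baseKer P (resSite r) t|

/-- The periodic majorant has an absolutely summable second moment if every base-point kernel has. [folklore] -/
theorem absMoment₂_periodicMajorant {P : Ker₂ d} (hPabs : ∀ b, AbsMoment₂ (baseKer P b)) :
    AbsMoment₂ (periodicMajorant N P) := by
  have h : (fun t => (1 + l1 t ^ 2) * |periodicMajorant N P t|)
      = fun t => ∑ r : Fin d → Fin N, (1 + l1 t ^ 2) * |baseKer P (resSite r) t| := by
    funext t
    rw [periodicMajorant, abs_of_nonneg (Finset.sum_nonneg fun r _ => abs_nonneg _), Finset.mul_sum]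
  unfold AbsMoment₂
  rw [h]
  exact summable_sum fun r _ => hPabs (resSite r)

/-- … and dominates every base-point kernel (`0 < N`, block periodicity). [folklore] -/
theorem abs_baseKer_le_periodicMajorant (hN : 0 < N) {P : Ker₂ d} (hP : IsBlockPeriodic N P) (b t : Fin d → ℤ) :
    |P (b + t) b| ≤ periodicMajorant N P t := by
  obtain ⟨z, hz⟩ := eq_resSite_add hN b
  have e : P (b + t) b = baseKer P (resSite (resOf hN b)) t := by
    rw [← baseKer_add_zsmul hP (resSite (resOf hN b)) z, ← hz]; rfl
  rw [e]
  exact Finset.single_le_sum (f := fun r => |baseKer P (resSite r) t|) (fun r _ => abs_nonneg _)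
    (Finset.mem_univ (resOf hN b))

/-! ## §2 The dressed sum with a two-point kernel; regrouping by the coarse point; decimation -/

/-- THE TWO-SIDED DRESSED SUM with a two-point fine kernel, at the coarse output point `y`:
`dressedSumP w P w' y = Σ'_{(u,x)} w u · P (y + u) x · w' x` — the sandwich `Σ_{s,s'} W(s − N Y) P(s, s') W'(s' − N Y')`
read at `y = N (Y − Y')` after one joint block translation. [folklore] -/
noncomputable def dressedSumP (w : (Fin d → ℤ) → ℝ) (P : Ker₂ d) (w' : (Fin d → ℤ) → ℝ) (y : Fin d → ℤ) : ℝ :=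
  ∑' p : (Fin d → ℤ) × (Fin d → ℤ), w p.1 * P (y + p.1) p.2 * w' p.2

/-- CONSISTENCY: for `P s s' = T (s − s')` this IS `DecimatedMomentSummable.dressedSum w T w'`. [folklore] -/
theorem dressedSumP_of_transl (w T w' : (Fin d → ℤ) → ℝ) :
    dressedSumP w (fun s s' => T (s - s')) w' = dressedSum w T w' := by
  funext y
  rfl

/-- Fibrewise summability of the dressed sum from the majorant. [folklore] -/
theorem summable_dressedP_fibre {w w' F : (Fin d → ℤ) → ℝ} {P : Ker₂ d} (hw : AbsMoment₂ w) (hF : AbsMoment₂ F)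
    (hw' : AbsMoment₂ w') (hPF : ∀ b t, |P (b + t) b| ≤ F t) (y : Fin d → ℤ) :
    Summable (fun p : (Fin d → ℤ) × (Fin d → ℤ) => w p.1 * P (y + p.1) p.2 * w' p.2) := by
  set M := ∑' t, (1 + l1 t ^ 2) * |F t| with hMdef
  have hwa : Summable (fun u => |w u|) := (summable_of_absMoment₂ hw).abs
  have hw'a : Summable (fun x => |w' x|) := (summable_of_absMoment₂ hw').abs
  have hM0 : 0 ≤ M := (abs_nonneg _).trans (abs_le_tsum_of_majorant hF hPF 0 0)
  have hS : Summable (fun p : (Fin d → ℤ) × (Fin d → ℤ) => (|w p.1| * M) * |w' p.2|) :=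
    (hwa.mul_right _).mul_of_nonneg hw'a (fun u => mul_nonneg (abs_nonneg _) hM0) (fun x => abs_nonneg _)
  refine Summable.of_norm_bounded hS (fun p => ?_)
  rw [Real.norm_eq_abs, abs_mul, abs_mul]
  exact mul_le_mul_of_nonneg_right (mul_le_mul_of_nonneg_left (abs_le_tsum_of_majorant hF hPF _ _) (abs_nonneg _))
    (abs_nonneg _)

/-- The triple family with a weight depending on the coarse point only, read in the coarse coordinates
`(u, (t, x)) ↦ (t + x − u, (u, x))` (`DecimatedMomentSummable.coarseEquiv`). [folklore] -/
theorem termP_comp_coarseEquiv_symm (w : (Fin d → ℤ) → ℝ) (P : Ker₂ d) (w' : (Fin d → ℤ) → ℝ)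
    (φ : (Fin d → ℤ) → ℤ) (y u x : Fin d → ℤ) :
    (termP N w P w' (fun u t x => φ (t + x - u)) ∘ ⇑(coarseEquiv (d := d)).symm) (y, u, x)
      = (cosetInd N y * φ y) • (w u * P (y + u) x * w' x) := by
  show termP N w P w' (fun u t x => φ (t + x - u)) (u, y + u - x, x) = _
  rw [termP_apply, show y + u - x + x - u = y by abel, show x + (y + u - x) = y + u by abel]

/-- **REGROUPING BY THE COARSE OUTPUT POINT**: a sum of the triple family with weight `φ(t+x−u)` is a sum of the
coarse-point family `y ↦ (cosetInd N y · φ y) • dressedSumP w P w' y` (fibrewise summability of the dressed sum).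
[folklore] -/
theorem hasSum_coarseP (w : (Fin d → ℤ) → ℝ) (P : Ker₂ d) (w' : (Fin d → ℤ) → ℝ) (φ : (Fin d → ℤ) → ℤ) {a : ℝ}
    (h : HasSum (termP N w P w' (fun u t x => φ (t + x - u))) a)
    (hK : ∀ y, Summable (fun p : (Fin d → ℤ) × (Fin d → ℤ) => w p.1 * P (y + p.1) p.2 * w' p.2)) :
    HasSum (fun y => (cosetInd N y * φ y) • dressedSumP w P w' y) a := by
  have hF := (Equiv.hasSum_iff (coarseEquiv (d := d)).symm).mpr h
  refine hF.prod_fiberwise (fun y => ?_)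
  show HasSum _ ((cosetInd N y * φ y) • ∑' p : (Fin d → ℤ) × (Fin d → ℤ), w p.1 * P (y + p.1) p.2 * w' p.2)
  refine ((hK y).hasSum.const_smul (cosetInd N y * φ y)).congr_fun (fun p => ?_)
  obtain ⟨u, x⟩ := p
  exact termP_comp_coarseEquiv_symm w P w' φ y u x

/-- DECIMATION: the coarse-point form with weight `y_κ y_λ` IS the coarse-lattice form `y = N • z` with weight
`N² · z_κ z_λ` (`N ≠ 0`; `DecimatedMomentLimit.hasSum_decimate_iff`). [folklore] -/
theorem hasSum_latticeP_iff (hN : N ≠ 0) (K : (Fin d → ℤ) → ℝ) (κ l : Fin d) (a : ℝ) :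
    HasSum (fun z : Fin d → ℤ => ((N : ℤ) ^ 2 * (z κ * z l)) • K ((N : ℤ) • z)) a
      ↔ HasSum (fun y => (cosetInd N y * (y κ * y l)) • K y) a := by
  rw [← hasSum_decimate_iff hN (fun y => y κ * y l) K a]
  refine ⟨fun h => h.congr_fun (fun z => ?_), fun h => h.congr_fun (fun z => ?_)⟩
  · simp only [weight_zsmul]
  · simp only [weight_zsmul]

/-! ## §3 (T1-avg) for free: a SYMMETRIC block-periodic kernel has vanishing base-point-summed first moments -/

/-- Residue shift is injective: `r ↦ resOf (resSite r − τ)` on `Fin d → Fin N` (`0 < N`). [folklore] -/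
theorem resOf_resSite_sub_injective (hN : 0 < N) (τ : Fin d → ℤ) :
    Function.Injective (fun r : Fin d → Fin N => resOf hN (resSite r - τ)) := by
  intro r₁ r₂ h
  have h' : resOf hN (resSite r₁ - τ) = resOf hN (resSite r₂ - τ) := h
  have h1 : ∀ i, (N : ℤ) ∣ (resSite (resOf hN (resSite r₁ - τ)) - (resSite r₁ - τ)) i :=
    (dvd_resSite_sub_iff hN _ _).2 rfl
  have h2 : ∀ i, (N : ℤ) ∣ (resSite (resOf hN (resSite r₂ - τ)) - (resSite r₂ - τ)) i :=
    (dvd_resSite_sub_iff hN _ _).2 rfl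
  rw [h'] at h1
  funext i
  have hd : (N : ℤ) ∣ ((r₁ i : ℕ) : ℤ) - ((r₂ i : ℕ) : ℤ) := by
    have := dvd_sub (h2 i) (h1 i)
    have e : (resSite (resOf hN (resSite r₂ - τ)) - (resSite r₂ - τ)) i
        - (resSite (resOf hN (resSite r₂ - τ)) - (resSite r₁ - τ)) i = ((r₁ i : ℕ) : ℤ) - ((r₂ i : ℕ) : ℤ) := by
      simp only [Pi.sub_apply, resSite]
      ring
    rwa [e] at this
  have hlt : |((r₁ i : ℕ) : ℤ) - ((r₂ i : ℕ) : ℤ)| < (N : ℤ) := by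
    have a1 := (r₁ i).isLt
    have a2 := (r₂ i).isLt
    rw [abs_lt]
    constructor <;> omega
  have h0 := Int.eq_zero_of_abs_lt_dvd hd hlt
  exact Fin.ext (by omega)

/-- SHIFTED RESIDUE SYSTEMS: a block-periodic function summed over the residue sites shifted by any `τ` gives the same
value as over the residue sites themselves. [folklore] -/
theorem sum_resSite_sub_eq (hN : 0 < N) {m : (Fin d → ℤ) → ℝ} (hm : ∀ b z : Fin d → ℤ, m (b + (N : ℤ) • z) = m b)
    (τ : Fin d → ℤ) : ∑ r : Fin d → Fin N, m (resSite r - τ) = ∑ r : Fin d → Fin N, m (resSite r) := by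
  have hper : ∀ r : Fin d → Fin N, m (resSite r - τ) = m (resSite (resOf hN (resSite r - τ))) :=
    fun r => periodic_apply_eq_resSite hN hm _
  simp_rw [hper]
  exact Function.Bijective.sum_comp
    ((Finite.injective_iff_bijective).1 (resOf_resSite_sub_injective hN τ)) (fun r => m (resSite r))

/-- First-moment families of the base-point kernels are summable, uniformly dominated by the majorant — also along a
base point MOVING with the displacement (`b − t`), since the majorant is base-point uniform. [folklore] -/
theorem summable_firstMoment_of_majorant {F : (Fin d → ℤ) → ℝ} {P : Ker₂ d} (hF : AbsMoment₂ F)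
    (hPF : ∀ b t, |P (b + t) b| ≤ F t) (μ : Fin d) (b : Fin d → ℤ) (c : ℤ) :
    Summable (fun t => (t μ : ℝ) * baseKer P (b - c • t) t) := by
  refine Summable.of_norm_bounded hF (fun t => ?_)
  rw [Real.norm_eq_abs, abs_mul]
  have h1 : |(t μ : ℝ)| ≤ 1 + l1 t ^ 2 := abs_le_of_isMoment₂ (IsMoment₂.coord μ) t
  have h2 : |baseKer P (b - c • t) t| ≤ |F t| := (hPF _ t).trans (le_abs_self _)
  exact mul_le_mul h1 h2 (abs_nonneg _) (by positivity)

/-- **(T1-avg) FOR A SYMMETRIC KERNEL.**  `P` block periodic, SYMMETRIC (`P s s' = P s' s`), with a base-point-uniform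
majorant of absolutely summable second moment: for every `μ`, `Σ_{classes b} Σ'_t t_μ · P (b+t) b = 0`.  (Symmetry and
`t ↦ −t` turn the class sum into minus the same sum over the residue system shifted by `t`, which is the unshifted one by
periodicity; the POINTWISE first moments need not vanish.) [folklore] -/
theorem sum_firstMoment_baseKer_eq_zero_of_symm (hN : 0 < N) {P : Ker₂ d} (hP : IsBlockPeriodic N P)
    (hsymm : ∀ s s', P s s' = P s' s) {F : (Fin d → ℤ) → ℝ} (hF : AbsMoment₂ F) (hPF : ∀ b t, |P (b + t) b| ≤ F t)
    (μ : Fin d) : ∑ r : Fin d → Fin N, ∑' t, (t μ : ℝ) * baseKer P (resSite r) t = 0 := by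
  set S := ∑ r : Fin d → Fin N, ∑' t, (t μ : ℝ) * baseKer P (resSite r) t with hS
  have hsum0 : ∀ b, Summable (fun t => (t μ : ℝ) * baseKer P b t) := fun b => by
    simpa only [zero_smul, sub_zero] using summable_firstMoment_of_majorant hF hPF μ b 0
  have hsum1 : ∀ b, Summable (fun t => (t μ : ℝ) * baseKer P (b - t) t) := fun b => by
    simpa only [one_smul] using summable_firstMoment_of_majorant hF hPF μ b 1
  -- symmetry + reflection of the displacement, at every base point
  have h1 : ∀ b, ∑' t, (t μ : ℝ) * baseKer P b t = -∑' t, (t μ : ℝ) * baseKer P (b - t) t := by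
    intro b
    rw [← tsum_neg]
    conv_lhs => rw [← (Equiv.neg (Fin d → ℤ)).tsum_eq]
    refine tsum_congr (fun t => ?_)
    simp only [Equiv.neg_apply, baseKer, Pi.neg_apply, Int.cast_neg, sub_add_cancel]
    rw [← sub_eq_add_neg, hsymm (b - t) b]
    ring
  -- the shifted class sum is the unshifted one
  have h2 : ∑ r : Fin d → Fin N, ∑' t, (t μ : ℝ) * baseKer P (resSite r - t) t = S := by
    rw [hS, ← Summable.tsum_finsetSum (fun r _ => hsum1 (resSite r)),
      ← Summable.tsum_finsetSum (fun r _ => hsum0 (resSite r))]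
    refine tsum_congr (fun t => ?_)
    rw [← Finset.mul_sum, ← Finset.mul_sum,
      sum_resSite_sub_eq hN (m := fun b => baseKer P b t) (fun b z => by rw [baseKer_add_zsmul hP]) t]
  have h3 : S = -S := by
    calc S = ∑ r : Fin d → Fin N, -∑' t, (t μ : ℝ) * baseKer P (resSite r - t) t := by
          rw [hS]; exact Finset.sum_congr rfl (fun r _ => h1 (resSite r))
      _ = -S := by rw [Finset.sum_neg_distrib, h2]
  linarith

/-! ## §4 The finals over `ℝ`: masses × the sum over base points of the fine second moment -/

/-- Kernel moment families as `HasSum` statements from absolutely summable base-point kernels. [folklore] -/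
theorem hasSum_moments_baseKer {P : Ker₂ d} (hPabs : ∀ b, AbsMoment₂ (baseKer P b)) (b : Fin d → ℤ) (κ l : Fin d) :
    HasSum (fun t => t κ • baseKer P b t) (∑' t, (t κ : ℝ) * baseKer P b t)
      ∧ HasSum (fun t => (t κ * t l) • baseKer P b t) (∑' t, (t κ : ℝ) * (t l : ℝ) * baseKer P b t) := by
  have e1 : (fun t : Fin d → ℤ => t κ • baseKer P b t) = fun t => (t κ : ℝ) * baseKer P b t :=
    funext (fun t => zsmul_eq_mul _ _)
  have e2 : (fun t : Fin d → ℤ => (t κ * t l) • baseKer P b t) = fun t => (t κ : ℝ) * (t l : ℝ) * baseKer P b t :=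
    funext (fun t => by rw [zsmul_eq_mul, Int.cast_mul])
  refine ⟨?_, ?_⟩
  · have := (summable_smul_of_absMoment₂ (hPabs b) (IsMoment₂.coord κ)).hasSum
    rwa [e1] at this ⊢
  · have := (summable_smul_of_absMoment₂ (hPabs b) (IsMoment₂.coord2 κ l)).hasSum
    rwa [e2] at this ⊢

/-- **THE BLOCK-PERIODIC MOMENT TRANSFER, every summability discharged** (`0 < N`).  Patterns `w, w'` with absolutely
summable second moments reproducing constants (`σ`, `σ'`) AND affine functions (`C`, `C'`) through `N•ℤ^d`; a block
periodic two-point kernel `P` whose base-point kernels have absolutely summable second moments, whose COLUMNS and ROWS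
sum to zero at every point (`Σ_s P s b = 0 = Σ_{s'} P b s'`), and whose base-point-summed first moments vanish.  Then the
`N•ℤ^d`-windowed second moment of the sandwich — as the triple family, and as `Σ_y (cosetInd N y · y_κ y_λ) • dressedSumP
w P w' y` — HAS THE SUM `σ · σ' · Σ_{classes b} Σ'_t t_κ t_λ P (b+t) b`. [folklore] -/
theorem decimatedSumP_second_moment (hN : 0 < N) {w w' : (Fin d → ℤ) → ℝ} {P : Ker₂ d} (hP : IsBlockPeriodic N P)
    (hw : AbsMoment₂ w) (hw' : AbsMoment₂ w') (hPabs : ∀ b, AbsMoment₂ (baseKer P b)) {σ σ' : ℝ} {C C' : Fin d → ℝ}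
    (hL0 : ConstReproSum N w σ) (hL1 : LinReproSum N w C) (hR0 : ConstReproSum N w' σ') (hR1 : LinReproSum N w' C')
    (hcol : ∀ b, HasSum (fun s => P s b) 0) (hrow : ∀ b, HasSum (P b) 0)
    (hT1 : ∀ μ, ∑ r : Fin d → Fin N, ∑' t, (t μ : ℝ) * baseKer P (resSite r) t = 0) (κ l : Fin d) :
    HasSum (termP N w P w' (fun u t x => (t + x - u) κ * (t + x - u) l))
        (σ * σ' * ∑ r : Fin d → Fin N, ∑' t, (t κ : ℝ) * (t l : ℝ) * baseKer P (resSite r) t)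
      ∧ HasSum (fun y => (cosetInd N y * (y κ * y l)) • dressedSumP w P w' y)
        (σ * σ' * ∑ r : Fin d → Fin N, ∑' t, (t κ : ℝ) * (t l : ℝ) * baseKer P (resSite r) t) := by
  have hF : AbsMoment₂ (periodicMajorant N P) := absMoment₂_periodicMajorant hPabs
  have hPF : ∀ b t, |P (b + t) b| ≤ periodicMajorant N P t := abs_baseKer_le_periodicMajorant hN hP
  have hS : MonoSummableP N w P w' := monoSummableP_of_majorant hw hF hw' hPF
  have hcol' : ∀ b, HasSum (baseKer P b) 0 := fun b =>
    ((Equiv.hasSum_iff (Equiv.addLeft b)).mpr (hcol b)).congr_fun (fun _ => rfl)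
  have A := hasSum_termP_second_of_vanishing w P w' hN hP hL0 hL1 hR0 hR1 κ l
    (m₁ := fun μ b => ∑' t, (t μ : ℝ) * baseKer P b t) (m₂ := fun b => ∑' t, (t κ : ℝ) * (t l : ℝ) * baseKer P b t)
    hcol' hrow (fun b μ => (hasSum_moments_baseKer hPabs b μ l).1) hT1
    (fun b => (hasSum_moments_baseKer hPabs b κ l).2) hS
  exact ⟨A, hasSum_coarseP w P w' (fun y => y κ * y l) A (summable_dressedP_fibre hw hF hw' hPF)⟩

/-- **… ON THE COARSE LATTICE** (`y = N • z`, weight `N² · z_κ z_λ`). [folklore] -/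
theorem decimatedSumP_second_moment_lattice (hN : 0 < N) {w w' : (Fin d → ℤ) → ℝ} {P : Ker₂ d}
    (hP : IsBlockPeriodic N P) (hw : AbsMoment₂ w) (hw' : AbsMoment₂ w') (hPabs : ∀ b, AbsMoment₂ (baseKer P b))
    {σ σ' : ℝ} {C C' : Fin d → ℝ}
    (hL0 : ConstReproSum N w σ) (hL1 : LinReproSum N w C) (hR0 : ConstReproSum N w' σ') (hR1 : LinReproSum N w' C')
    (hcol : ∀ b, HasSum (fun s => P s b) 0) (hrow : ∀ b, HasSum (P b) 0)
    (hT1 : ∀ μ, ∑ r : Fin d → Fin N, ∑' t, (t μ : ℝ) * baseKer P (resSite r) t = 0) (κ l : Fin d) :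
    HasSum (fun z : Fin d → ℤ => ((N : ℤ) ^ 2 * (z κ * z l)) • dressedSumP w P w' ((N : ℤ) • z))
      (σ * σ' * ∑ r : Fin d → Fin N, ∑' t, (t κ : ℝ) * (t l : ℝ) * baseKer P (resSite r) t) :=
  (hasSum_latticeP_iff hN.ne' _ κ l _).2
    (decimatedSumP_second_moment hN hP hw hw' hPabs hL0 hL1 hR0 hR1 hcol hrow hT1 κ l).2

/-- **SYMMETRIC KERNEL KILLING CONSTANTS**: for a SYMMETRIC block-periodic `P` (`P s s' = P s' s`) whose rows sum to
zero at every point, the columns sum to zero too and (T1-avg) is automatic (§3) — the coarse-lattice second moment of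
the sandwich is `σ · σ' · Σ_{classes b} Σ'_t t_κ t_λ P (b+t) b` with NO first-moment hypothesis. [folklore] -/
theorem decimatedSumP_second_moment_lattice_of_symm (hN : 0 < N) {w w' : (Fin d → ℤ) → ℝ} {P : Ker₂ d}
    (hP : IsBlockPeriodic N P) (hsymm : ∀ s s', P s s' = P s' s) (hw : AbsMoment₂ w) (hw' : AbsMoment₂ w')
    (hPabs : ∀ b, AbsMoment₂ (baseKer P b)) {σ σ' : ℝ} {C C' : Fin d → ℝ}
    (hL0 : ConstReproSum N w σ) (hL1 : LinReproSum N w C) (hR0 : ConstReproSum N w' σ') (hR1 : LinReproSum N w' C')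
    (hrow : ∀ b, HasSum (P b) 0) (κ l : Fin d) :
    HasSum (fun z : Fin d → ℤ => ((N : ℤ) ^ 2 * (z κ * z l)) • dressedSumP w P w' ((N : ℤ) • z))
      (σ * σ' * ∑ r : Fin d → Fin N, ∑' t, (t κ : ℝ) * (t l : ℝ) * baseKer P (resSite r) t) := by
  have hcol : ∀ b, HasSum (fun s => P s b) 0 := fun b => (hrow b).congr_fun (fun s => hsymm s b)
  exact decimatedSumP_second_moment_lattice hN hP hw hw' hPabs hL0 hL1 hR0 hR1 hcol hrow
    (sum_firstMoment_baseKer_eq_zero_of_symm hN hP hsymm (absMoment₂_periodicMajorant hPabs)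
      (abs_baseKer_le_periodicMajorant hN hP)) κ l

end Summit.QuantumFields.BalabanUV.Beta.D1BFx.MomentTransferPeriodicSum
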